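import Summits.QuantumFields.YangMills.Theorems.UV3ACBounds5Upper
import Summits.QuantumFields.YangMills.Theorems.AlphaInputsT3ACv3Pint
import HarnessLib

/-!
# `UV3ACBounds5UpperRows` — R3 (cell `ym3-torus`, YM₃ on T³ — a ladder RUNG, NOT d = 4, NOT infinite volume, NOT a mass gap, NOT the Clay problem):
# **THE THREE PER-HEIGHT ROWS OF `UV3ACBounds5Upper` DISCHARGED FROM THE v3 (α) PACKAGE** — (46) `Pint`, (62)–(65) `Ecst`, the remainder `Rm` of (41) — and
# **[Balaban1985UV3] THM 1 (5) UPPER, HEIGHTWISE, FOR THE PINNED `ℰp` DENSITIES, CONDITIONAL ON THE v3 PACKAGE ONLY**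

Width seat `ym3-torus-px8` g15 (★★OWNER WORDs 102∕103, (O-UP) FILE 3 — pre-cleared).  THEOREMS ONLY (0 `def`, 0 `sorry`, default heartbeats); `--supports stmt-QuantumFields-20520
--as helper`; count-neutral.  Everything is Sect. D bookkeeping of [Balaban1985UV3] over LANDED lane theorems at the v3 package's AC tower `p.T = towerOfAC 𝔠.lane p.X p.𝔖`
(`p : AlphaInputsT3AC.PkgAtV3 F 𝔠 γ hγ hγ1 K`); nothing of Bałaban's analysis is asserted.
* §1 `Rm_height_le_v3` — the remainder: `Rm_{K−n} ≤ (r⋆∕(1 − L^{−κ₀}))·N_n³` (v3 API ✓`PkgAtV3.Rm_eq` + lit ✓`B10LargeFieldSum.geomTail_le`; `γ ≤ 1`).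
* §2 `abs_Pint_le_level` ∕ `abs_Pint_le_height` — (46): `|Pint_j(r, W)| ≤ (C46·M₁³)·θBal(K − j + 1)²·#T^{(j)}` at every level (`j = 0`: no interaction, `InputsAC.noInteraction0_towerOfAC`;
  `j = k + 1`: ✓`PkgAtV3.abs_Pint_succ_le` + ✓`card_lamFin_le_sitesPerDir_cube`); at `j = K − n`: `≤ (C46·M₁³)·θBal(n+1)²·N_n³`.
* §3 `abs_Estep_le` ∕ `abs_Ecst_le_height` — (62)–(65): per step `|E^{(j)}| ≤ (a₁ + 3dg·|log g_j|)·|T₁^{(j)}|` from the `rfl` leaf `Estep62` of the AC series and the (α) rows G3D-05 `logZT`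
  (✓`AlphaAdaptersAC.logZT_le_piecesAC`) and G3D-01 at the chart centre (✓`pprT_le_piecesAC`), the concrete star count (✓`ScalesArithmetic.starCount_univ_le_three_sites`); then lit
  ✓`B10.Ecst_abs_le_window` at the one-point window `g_{K−n} = √(γL^{−n})` ⟹ `|E_{K−n}| ≤ b_n·N_n³`, K-FREE.
* §4 ★★★★ `bounds5UpperAtHeight_of_v3` — lit `Bounds5UpperAtHeight F γ (fun K => (h.pkgAtV3 hc γ hγ hγ1 K).E)` from `AlphaInputsT3AC.OfV3At F 𝔠 a₀ a₁` and `0 < γ ≤ (min γ₀ 1)²`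
  ALONE (✓`UV3ACBounds5Upper.bounds5UpperAtHeight_of_v3_rows` with §1–§3).
HONEST SCOPE.  CONDITIONAL on the OPEN v3 (α) package (socket of record, RULING g18-№3); ⟨UP⟩ (`HeightwiseUpperBound`) needs (6)∕a lower letter on top; PERS₁∘∕TUBE∘∕20520∕19936, the rung,
d = 4, a mass gap or Clay are NOT proved; the Yang–Mills mass gap is NOT proved.

References: T. Bałaban, Commun. Math. Phys. **102** (1985) 255–275 [Balaban1985UV3] ((5) p.256, Thm 1 p.257, (41) p.266, (46) p.267, (62) p.271, (64)–(65) p.273, Sect. D pp.272–274).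
-/

set_option autoImplicit false

noncomputable section

namespace Summit.QuantumFields.YangMills.Theorems.UV3ACBounds5UpperRows

open MeasureTheory
open scoped BigOperators
open Literature.MathematicalPhysics.QuantumFieldTheory.Balaban1983to89
open Literature.MathematicalPhysics.QuantumFieldTheory.Balaban1983to89.T3ContinuumYM3Torus
open Literature.MathematicalPhysics.QuantumFieldTheory.Balaban1983to89.T3UnitScaleTilt (θBal)
open Literature.MathematicalPhysics.QuantumFieldTheory.Balaban1983to89.T3HeightwiseDensityBounds (Bounds5UpperAtHeight)
open Literature.MathematicalPhysics.QuantumFieldTheory.Balaban1983to89.B12TreeDecay (kappa₀ K₀)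
open Literature.MathematicalPhysics.QuantumFieldTheory.Balaban1983to89.TreeLengthTorus (tsys)
open Literature.MathematicalPhysics.QuantumFieldTheory.Balaban1985CMP102
open Literature.MathematicalPhysics.QuantumFieldTheory.Balaban1985CMP102.Setting
open Summit.QuantumFields.Balaban3D.Carriers
open Summit.QuantumFields.Balaban3D.Proofs.Primitives
open Summit.QuantumFields.Balaban3D.Proofs.ScalesArithmetic (gk_pos gk_le_one g0sq_pos gk_eq_gRun_norm sites_eq_sitesRun_norm normVol_nonneg
  starCount_univ_nonneg starCount_univ_le_three_sites sites_eq_sitesPerDir_pow sites_nonneg)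
open Summit.QuantumFields.Balaban3D.Proofs.GroupModelLieC (lieC)
open Summit.QuantumFields.Balaban3D.Proofs.TowerAC
open Summit.QuantumFields.Balaban3D.Proofs.StandardAC
open Summit.QuantumFields.Balaban3D.Proofs.InputsAC
open Summit.QuantumFields.Balaban3D.Proofs.AlphaAC (AlphaDataAC)
open Summit.QuantumFields.Balaban3D.Proofs.AlphaAdaptersAC (logZT_le_piecesAC pprT_le_piecesAC)
open Summit.QuantumFields.YangMills.Theorems.AlphaV3AC
open Summit.QuantumFields.YangMills.Theorems.UV3ACBounds5Upper (bounds5UpperAtHeight_of_v3_rows card_site_level_eq)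

variable {F : T3Family} {𝔠 : AlphaConsts F.L (suGroupModel 2).N} {γ : ℝ} {hγ : 0 < γ} {hγ1 : γ ≤ (min 𝔠.gamma0 1) ^ 2} {K : ℕ}

/-- The height-`n` site count is the level-`(K−n)` site count of run `K` (K-FREE): `|T₁^{(K−n)}| = N_n³`. [cite: Balaban1985UV3, p.256] -/
theorem sites_level_eq (p : AlphaInputsT3AC.PkgAtV3 F 𝔠 γ hγ hγ1 K) {n : ℕ} (_hK : n ≤ K) :
    p.T.sites (K - n) = ((F.P n).sitesPerDir 0 : ℝ) ^ 3 := by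
  show (T3Scales F γ hγ (hγ1.trans (sq_min_one_le _ 𝔠.gamma0_pos)) K).sites (K - n) = _
  rw [sites_eq_sitesPerDir_pow _ (K - n) (by show K - n ≤ F.m + K; omega)]
  have hs : (F.P K).sitesPerDir (K - n) = (F.P n).sitesPerDir 0 :=
    (F.sitesPerDir_eq (m := F.m) (K := n) (j := 0) (m' := F.m) (K' := K) (j' := K - n) (by omega)).symm
  show (((F.P K).sitesPerDir (K - n) : ℕ) : ℝ) ^ 3 = _
  rw [hs]

/-! ## §1 The remainder row -/

/-- **THE REMAINDER OF (41) AT HEIGHT `n` IS `O(1)·N_n³`, K-FREE**: `Rm_{K−n} ≤ (r⋆∕(1 − L^{−κ₀}))·N_n³` (any `n`, `K`; for `n > K` the level is `0` and `Rm_0 = 0`) — v3 API ✓`PkgAtV3.Rm_eq` (`Rm_j = r⋆γ^{3+κ₀}(Σ_{i<j}q^{K−i})(2L^m)³`, `q = L^{−κ₀}`),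
`q^{K−i} ≤ q^{j−i}`, lit ✓`geomTail_le`, `γ^{3+κ₀} ≤ 1`, `(2L^m)³ ≤ N_n³`. [cite: Balaban1985UV3, (41) p.266] -/
theorem Rm_height_le_v3 (p : AlphaInputsT3AC.PkgAtV3 F 𝔠 γ hγ hγ1 K) (n : ℕ) :
    p.T.Rm (K - n) ≤ 𝔠.stepConsts.rstar / (1 - ((F.L : ℝ)⁻¹) ^ 𝔠.κ₀) * ((F.P n).sitesPerDir 0 : ℝ) ^ 3 := by
  have hL1 : (1 : ℝ) < F.L := by exact_mod_cast F.hL.2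
  have hL0 : (0 : ℝ) < F.L := by linarith
  have hγ1' : γ ≤ 1 := hγ1.trans (sq_min_one_le _ 𝔠.gamma0_pos)
  set q : ℝ := ((F.L : ℝ)⁻¹) ^ 𝔠.κ₀ with hq
  have hq0 : 0 ≤ q := Real.rpow_nonneg (inv_nonneg.mpr hL0.le) _
  have hq1 : q < 1 := Real.rpow_lt_one (inv_nonneg.mpr hL0.le) (inv_lt_one_of_one_lt₀ hL1) 𝔠.κ₀_pos
  have hr : 0 ≤ 𝔠.stepConsts.rstar := 𝔠.stepConsts.rstar_nonneg
  rw [p.Rm_eq (K - n) (Nat.sub_le K n)]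
  -- the geometric factor
  have hgeo : ∑ i ∈ Finset.range (K - n), q ^ (K - i) ≤ 1 / (1 - q) := by
    have h1 : ∑ i ∈ Finset.range (K - n), q ^ (K - i) ≤ ∑ i ∈ Finset.range (K - n), q ^ (K - n - i) :=
      Finset.sum_le_sum fun i hi => by
        rw [Finset.mem_range] at hi
        exact pow_le_pow_of_le_one hq0 hq1.le (by omega)
    refine h1.trans ((B10LargeFieldSum.geomTail_le hq0 hq1 (K - n)).trans ?_)
    exact div_le_div_of_nonneg_right (hq1.le) (by linarith)
  -- `γ^{3+κ₀} ≤ 1`, `(2L^m)³ ≤ N_n³`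
  have hγp : γ ^ (3 + 𝔠.κ₀) ≤ 1 := Real.rpow_le_one hγ.le hγ1' (by linarith [𝔠.κ₀_pos])
  have hγp0 : 0 ≤ γ ^ (3 + 𝔠.κ₀) := Real.rpow_nonneg hγ.le _
  have hN : (2 * (F.L : ℝ) ^ F.m) ^ 3 ≤ ((F.P n).sitesPerDir 0 : ℝ) ^ 3 := by
    have h1 : ((F.P n).sitesPerDir 0 : ℝ) = 2 * (F.L : ℝ) ^ (F.m + n) := by
      rw [show (F.P n).sitesPerDir 0 = 2 * F.L ^ (F.m + n) by simp [Params.sitesPerDir]]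
      push_cast; ring
    rw [h1, pow_add]
    have h2 : (1 : ℝ) ≤ (F.L : ℝ) ^ n := one_le_pow₀ hL1.le
    have h3 : (0 : ℝ) ≤ 2 * (F.L : ℝ) ^ F.m := by positivity
    exact pow_le_pow_left₀ h3 (by nlinarith) 3
  have hN0 : (0 : ℝ) ≤ (2 * (F.L : ℝ) ^ F.m) ^ 3 := by positivity
  have hgeo0 : 0 ≤ ∑ i ∈ Finset.range (K - n), q ^ (K - i) := Finset.sum_nonneg fun i _ => pow_nonneg hq0 _
  have h1q : 0 < 1 - q := by linarith
  calc 𝔠.stepConsts.rstar * γ ^ (3 + 𝔠.κ₀) * (∑ i ∈ Finset.range (K - n), q ^ (K - i)) * (2 * (F.L : ℝ) ^ F.m) ^ 3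
      ≤ 𝔠.stepConsts.rstar * 1 * (1 / (1 - q)) * ((F.P n).sitesPerDir 0 : ℝ) ^ 3 := by
        gcongr
    _ = 𝔠.stepConsts.rstar / (1 - q) * ((F.P n).sitesPerDir 0 : ℝ) ^ 3 := by ring

/-! ## §2 The interaction row (46) -/

/-- **(46) AT EVERY LEVEL**: `|Pint_j(r, W)| ≤ (C46·M₁³)·θBal(K − j + 1)²·((F.P K).sitesPerDir j)³` for `j ≤ K` — at `j = 0` there is no interaction
(`noInteraction0_towerOfAC`), at `j = k + 1` ✓`PkgAtV3.abs_Pint_succ_le` with `#Ω_{k+1}^{(k+1)}(r) ≤ #T^{(k+1)}` (✓`card_lamFin_le_sitesPerDir_cube`). [cite: Balaban1985UV3, (46) p.267] -/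
theorem abs_Pint_le_level (p : AlphaInputsT3AC.PkgAtV3 F 𝔠 γ hγ hγ1 K) (j : ℕ) (hj : j ≤ K) (r : Hist (F.P K) j)
    (W : GaugeField (F.P K) j (Matrix.specialUnitaryGroup (Fin 2) ℂ)) :
    |p.T.Pint j r W| ≤ (𝔠.C46 * (𝔠.M₁ : ℝ) ^ 3) * θBal F.L γ 𝔠.b₀ 𝔠.p₀ (K - j + 1) ^ 2 * ((F.P K).sitesPerDir j : ℝ) ^ 3 := by
  cases j with
  | zero =>
    have h0 : p.T.Pint 0 r W = 0 := noInteraction0_towerOfAC 𝔠.lane p.X p.𝔖 r W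
    rw [h0, abs_zero]
    have hC : 0 ≤ 𝔠.C46 * (𝔠.M₁ : ℝ) ^ 3 := mul_nonneg 𝔠.C46_nonneg (by positivity)
    positivity
  | succ k =>
    have h1 := p.abs_Pint_succ_le k hj r W
    have h2 := card_lamFin_le_sitesPerDir_cube (F := F) (K := K) 𝔠.lane.carrier.M₁
      (rcolOf (T3Scales F γ hγ (hγ1.trans (sq_min_one_le _ 𝔠.gamma0_pos)) K) 𝔠.lane.carrier) k r
    have hC : 0 ≤ (𝔠.C46 * (𝔠.M₁ : ℝ) ^ 3) * θBal F.L γ 𝔠.b₀ 𝔠.p₀ (K - k) ^ 2 :=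
      mul_nonneg (mul_nonneg 𝔠.C46_nonneg (by positivity)) (sq_nonneg _)
    rw [show K - (k + 1) + 1 = K - k by omega]
    exact h1.trans (mul_le_mul_of_nonneg_left h2 hC)

/-- **(46) AT HEIGHT `n`, K-FREE**: `|Pint_{K−n}(r, W)| ≤ (C46·M₁³)·θBal(n+1)²·N_n³` for every `K ≥ n`, history and field. [cite: Balaban1985UV3, (46) p.267] -/
theorem abs_Pint_le_height (p : AlphaInputsT3AC.PkgAtV3 F 𝔠 γ hγ hγ1 K) {n : ℕ} (hK : n ≤ K) (r : Hist (F.P K) (K - n))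
    (W : GaugeField (F.P K) (K - n) (Matrix.specialUnitaryGroup (Fin 2) ℂ)) :
    |p.T.Pint (K - n) r W| ≤ (𝔠.C46 * (𝔠.M₁ : ℝ) ^ 3) * θBal F.L γ 𝔠.b₀ 𝔠.p₀ (n + 1) ^ 2 * ((F.P n).sitesPerDir 0 : ℝ) ^ 3 := by
  have h := abs_Pint_le_level p (K - n) (Nat.sub_le K n) r W
  have hs : (F.P K).sitesPerDir (K - n) = (F.P n).sitesPerDir 0 :=
    (F.sitesPerDir_eq (m := F.m) (K := n) (j := 0) (m' := F.m) (K' := K) (j' := K - n) (by omega)).symm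
  rw [show K - (K - n) + 1 = n + 1 by omega, hs] at h
  exact h

/-! ## §3 The counterterm row (62)–(65) -/

/-- **(25) AT THE CHART CENTRE from the v3 (α) step rows** (the vacuum activities `Re Ψ_X(0)` of (62); G3D-01's bound at `B = 0` — twin of
✓`BalabanUVNodesN08SlotOfRecordFromAlphaAC.bound25_vac_of_alphaAC` for `StepAlphaV3AC`). [cite: Balaban1985UV3, (25) p.262] -/
theorem bound25_vac_of_alphaV3 {L : ℕ} {S : Scales L} {G : Type} [GaugeGroup G] [MeasurableSpace G] [HaarData G] {𝔊 : GroupModel G}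
    {𝔠 : AlphaConsts L 𝔊.N} {X : ExternalInputsAC S G} {𝔖 : ∀ k, StepSeries S G ↥(lieC 𝔊) (nblkOf S 𝔠.lane.carrier k) k}
    {𝔄 : AlphaDataAC 𝔊 𝔠 X 𝔖} {win : (k : ℕ) → Hist S.P (k + 1) → Set (GaugeField S.P (k + 1) G)}
    (k : ℕ) (A : StepAlphaV3AC 𝔊 𝔠 X 𝔖 𝔄 win k) :
    B10.Bound25Printed ⟨(tsys 3 (nblkOf S 𝔠.lane.carrier k)).Dom, GaugeField S.P (k + 1) G, (tsys 3 (nblkOf S 𝔠.lane.carrier k)).dj,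
      fun Y _ => ((𝔖 k).Ψ Y 0).re⟩ (S.gk k) 𝔠.κ 𝔠.C25 := by
  intro Y _
  have hρ : 0 < 𝔠.ρ := (A.chart Y).1
  exact (Complex.abs_re_le_norm _).trans ((A.chart Y).2.2 0 (Metric.mem_closedBall_self (by positivity)))

/-- **(62) PER STEP for the v3 package's tower**: `|E^{(j)}| ≤ (a₁ + 3dg·|log g_j|)·|T₁^{(j)}|` for `j < K`, `a₁ := 3|log σ₀| + z + aP` — the `rfl` leaf `Estep62` of the AC series
(`E^{(j)} = (log σ₀ + d(𝔤) log g_j)|T₁^{(j)*}| + log Z^{(j)}(T,1) + Σ_X𝒫′(X,1)`), the star count `0 ≤ |T*| ≤ 3|T|` (✓`starCount_univ_nonneg`∕`…_le_three_sites`), G3D-05 (✓`logZT_le_piecesAC`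
at the row `logZT`), (25) at the chart centre (✓`pprT_le_piecesAC`), via lit ✓`B10.Estep62_abs_le`. [cite: Balaban1985UV3, (62) p.271 + (65) p.273] -/
theorem abs_Estep_le (p : AlphaInputsT3AC.PkgAtV3 F 𝔠 γ hγ hγ1 K) (j : ℕ) (hj : j < K) :
    |p.T.Estep j| ≤ ((3 * |𝔠.lane.carrier.logσ₀| + 𝔠.lane.F.z + 𝔠.lane.F.aP) + (3 * 𝔠.lane.carrier.dg) * |Real.log (p.T.g j)|) * p.T.sites j := by
  set S := T3Scales F γ hγ (hγ1.trans (sq_min_one_le _ 𝔠.gamma0_pos)) K with hS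
  have hle := T3Scales_window F 𝔠 γ hγ hγ1 K
  have hj' : j + 1 ≤ K := hj
  have hE : p.T.Estep j = ((piecesAC 𝔠.lane p.X p.𝔖 j).logσ₀ + (piecesAC 𝔠.lane p.X p.𝔖 j).dg * Real.log (p.T.g j))
      * (piecesAC 𝔠.lane p.X p.𝔖 j).starT + (piecesAC 𝔠.lane p.X p.𝔖 j).logZT + (piecesAC 𝔠.lane p.X p.𝔖 j).PprT :=
    (p.X.toTowerBase 𝔠.lane.carrier).estep62_seriesAC _ _ j
  have hstarT : (piecesAC 𝔠.lane p.X p.𝔖 j).starT = (B10StarCount.starCount (Finset.univ : Finset (Site S.P (j + 1))) : ℝ) := rfl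
  have hσ : (piecesAC 𝔠.lane p.X p.𝔖 j).logσ₀ = 𝔠.lane.carrier.logσ₀ := rfl
  have hdg : (piecesAC 𝔠.lane p.X p.𝔖 j).dg = 𝔠.lane.carrier.dg := rfl
  have hsites : p.T.sites j = S.sites j := rfl
  have hZ := logZT_le_piecesAC 𝔠.lane p.X p.𝔖 j 𝔠.cT_pos rfl (p.run.steps j hj').logZT
  have hP := pprT_le_piecesAC 𝔠.lane p.X p.𝔖 j hj' (by linarith [𝔠.kappa_ge]) 𝔠.C25_nonneg rfl
    (bound25_vac_of_alphaV3 j (p.run.steps j hj'))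
  have h62 := B10.Estep62_abs_le (piecesAC 𝔠.lane p.X p.𝔖 j).logσ₀ (piecesAC 𝔠.lane p.X p.𝔖 j).dg (Real.log (p.T.g j))
    (piecesAC 𝔠.lane p.X p.𝔖 j).logZT (piecesAC 𝔠.lane p.X p.𝔖 j).PprT (piecesAC 𝔠.lane p.X p.𝔖 j).starT (S.sites j) 𝔠.lane.F.aP 𝔠.lane.F.z
    (piecesAC 𝔠.lane p.X p.𝔖 j).dg_nonneg
    (by rw [hstarT]; exact starCount_univ_nonneg S j (by show j + 1 ≤ F.m + K; omega))
    (by rw [hstarT]; exact starCount_univ_le_three_sites S j (by show j + 1 ≤ F.m + K; omega)) hZ hP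
  have hrw : p.T.Estep j = (piecesAC 𝔠.lane p.X p.𝔖 j).logσ₀ * (piecesAC 𝔠.lane p.X p.𝔖 j).starT
      + (piecesAC 𝔠.lane p.X p.𝔖 j).dg * Real.log (p.T.g j) * (piecesAC 𝔠.lane p.X p.𝔖 j).starT
      + (piecesAC 𝔠.lane p.X p.𝔖 j).logZT + (piecesAC 𝔠.lane p.X p.𝔖 j).PprT := by
    rw [hE]; ring
  rw [hrw, hsites]
  refine h62.trans (mul_le_mul_of_nonneg_right (le_of_eq ?_) (sites_nonneg S j))
  rw [hσ, hdg]

/-- **(64)–(65) AT HEIGHT `n`, K-FREE**: `|E_{K−n}| ≤ b_n·N_n³` with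
`b_n := (a₁ + 3dg·|log g_n|)∕(1 − L⁻³) + 3dg·(½log L)·L⁻³∕(1 − L⁻³)²`, `g_n = √(γL^{−n})`, `a₁ = 3|log σ₀| + z + aP` (lit ✓`B10.Ecst_abs_le_window` over §3's per-step bound, the printed flow in
normalised units ✓`gk_eq_gRun_norm`∕✓`sites_eq_sitesRun_norm`, the one-point window `g_{K−n} = g_n` ✓`T3Scales_gk_eq`). [cite: Balaban1985UV3, (64)–(65) p.273] -/
theorem abs_Ecst_le_height (p : AlphaInputsT3AC.PkgAtV3 F 𝔠 γ hγ hγ1 K) {n : ℕ} (hK : n ≤ K) :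
    |p.T.Ecst (K - n)| ≤
      (((3 * |𝔠.lane.carrier.logσ₀| + 𝔠.lane.F.z + 𝔠.lane.F.aP) + (3 * 𝔠.lane.carrier.dg) *
          max |Real.log (Real.sqrt (γ * ((F.L : ℝ)⁻¹) ^ n))| |Real.log (Real.sqrt (γ * ((F.L : ℝ)⁻¹) ^ n))|) / (1 - ((F.L : ℝ) ^ 3)⁻¹)
        + ((3 * 𝔠.lane.carrier.dg) * (Real.log F.L / 2)) * (((F.L : ℝ) ^ 3)⁻¹ / (1 - ((F.L : ℝ) ^ 3)⁻¹) ^ 2)) *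
        ((F.P n).sitesPerDir 0 : ℝ) ^ 3 := by
  set S := T3Scales F γ hγ (hγ1.trans (sq_min_one_le _ 𝔠.gamma0_pos)) K with hS
  have hL1 : (1 : ℝ) < F.L := by exact_mod_cast F.hL.2
  have hgn : p.T.g (K - n) = Real.sqrt (γ * ((F.L : ℝ)⁻¹) ^ n) := by
    have h := T3Scales_gk_eq F γ hγ (hγ1.trans (sq_min_one_le _ 𝔠.gamma0_pos)) K (K - n) (Nat.sub_le K n)
    rw [show K - (K - n) = n by omega] at h
    exact h
  have hgpos : 0 < Real.sqrt (γ * ((F.L : ℝ)⁻¹) ^ n) := by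
    rw [← hgn]; exact gk_pos S (K - n)
  have hdg : 0 ≤ 3 * 𝔠.lane.carrier.dg := by linarith [𝔠.lane.carrier.dg_nonneg]
  have ha₁ : 0 ≤ 3 * |𝔠.lane.carrier.logσ₀| + 𝔠.lane.F.z + 𝔠.lane.F.aP := by
    have h0 := abs_nonneg 𝔠.lane.carrier.logσ₀
    have hz : 0 ≤ 𝔠.lane.F.z := 𝔠.z_nonneg
    have ha : 0 ≤ 𝔠.lane.F.aP := 𝔠.aP_nonneg
    linarith
  have h := B10.Ecst_abs_le_window p.T 1 (F.L : ℝ) S.g0sq (S.g ^ 6 * S.volT)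
    (3 * |𝔠.lane.carrier.logσ₀| + 𝔠.lane.F.z + 𝔠.lane.F.aP) (3 * 𝔠.lane.carrier.dg) one_pos hL1 (g0sq_pos S) (normVol_nonneg S) ha₁ hdg
    (fun k => gk_eq_gRun_norm S k) (fun k => sites_eq_sitesRun_norm S k) (fun j hj => abs_Estep_le p j hj)
    (Real.sqrt (γ * ((F.L : ℝ)⁻¹) ^ n)) (Real.sqrt (γ * ((F.L : ℝ)⁻¹) ^ n)) hgpos (K - n) hgn.symm.le hgn.le
  rw [sites_level_eq p hK] at h
  exact h

/-! ## §4 Theorem 1 (5), upper half, heightwise — conditional on the v3 package only -/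

/-- ★★★★ **[Balaban1985UV3] THM 1 (5) UPPER, HEIGHTWISE — lit `Bounds5UpperAtHeight F γ E` VERBATIM — FOR THE PINNED `blockAvg ℰp` DENSITIES, FROM THE v3 (α) PACKAGE
ALONE**: for `h : AlphaInputsT3AC.OfV3At F 𝔠 a₀ a₁` (the socket of record, RULING g18-№3 — OPEN) and `0 < γ ≤ (min γ₀ 1)²`, with `E K :=` the package's start constant of run `K`
((62)∕(64)): for every height `n` ONE constant `O1_n` with `e^{−E_K}·heightDensity F γ hK univ V ≤ exp(O1_n·N_n³)` for `dU_n`-almost every `V` and EVERY `K ≥ n`.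
✓`bounds5UpperAtHeight_of_v3_rows` with §1 (`Rm`), §2 ((46)) and §3 ((62)–(65)).  WHAT IT IS NOT: ⟨UP⟩ = `HeightwiseUpperBound` still needs (6)∕a lower letter (lit
✓`heightwiseUpperBound_of_bounds5`, w5 ✓`heightwiseUpperBound_of_bounds5TwoSided`; the LEAD's UP∘-QUOT-V3 road gives it directly); nothing of the (α) rows is proved.
[cite: Balaban1985UV3, (5) p.256, Thm 1 p.257, (41) p.266, (46) p.267, (62) p.271, (64)–(65) p.273, Sect. D pp.272–274] -/
theorem bounds5UpperAtHeight_of_v3 {a₀ a₁ : ℝ} (h : AlphaInputsT3AC.OfV3At F 𝔠 a₀ a₁) (hc : 0 < a₀ ∧ 0 < a₁ ∧ 𝔠.B₃ * a₁ ≤ a₀)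
    (γ : ℝ) (hγ : 0 < γ) (hγ1 : γ ≤ (min 𝔠.gamma0 1) ^ 2) :
    Bounds5UpperAtHeight F γ (fun K => (h.pkgAtV3 hc γ hγ hγ1 K).E) :=
  bounds5UpperAtHeight_of_v3_rows h hc γ hγ hγ1
    (fun _ => ⟨_, fun K hK r W => abs_Pint_le_height (h.pkgAtV3 hc γ hγ hγ1 K) hK r W⟩)
    (fun _ => ⟨_, fun K hK => abs_Ecst_le_height (h.pkgAtV3 hc γ hγ hγ1 K) hK⟩)
    (fun n => ⟨_, fun K _ => Rm_height_le_v3 (h.pkgAtV3 hc γ hγ hγ1 K) n⟩)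

end Summit.QuantumFields.YangMills.Theorems.UV3ACBounds5UpperRows

end
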